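import Summits.ABC.IUTFork.Repair.RcatLana91OrderReading
import Summits.ABC.IUTFork.Cor312UnitCosetCoarse
import HarnessLib

/-!
# D-0123(C) IUT REPAIR-CATALOGUE, row RC-667 (LANA (9-1) ORDER variant), companion II: at the VERBATIM level, under ALL bridge
# hypotheses, the order variant is STRICTLY STRONGER than the typed Statement — the coarse-coset bed `kSetting p`

Record file (D-0012) of the abc-iut cell, seat abc-iut-rcat-tst-2 (tester, KERNEL-CLOSE column); PROOF-ONLY (no definition, no
instance, no notation). TAKES NO SIDE on [IUTchIII] Cor. 3.12 / [IUTchIV] Thm. 1.10, on any reading or on any author (D-0045);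
nothing here asserts abc proved or refuted. typed ≠ proved; located ≠ adjudicated.

`RcatLana91OrderReading` separates «dominated» (SOME possible image has log-volume `≥ −|log(q)|`) from the inequality at the
SKELETON level (abstract containers). THIS FILE gives the VERBATIM-level separating instance: abc-iut-w4-d101's coarse-coset bed
`Cor312Vol.UnitCosetCoarse.kSetting p` (one place, `l⋇ = 2`; possible images at `j ∈ 𝔽_l^⋇` = the moved sign pairs
`±ε q^{j²}(1+p𝒪)`, hull frame `{𝒪, q𝒪}`; a model of the typed interface, NOT of initial Θ-data), where `BridgeHyps` and the typed
`Statement` HOLD (w4-d101 `kSetting_bridgeHyps`, `kSetting_statement` — WITH EQUALITY `−|log(Θ)| = −|log(q)| = −log p`, by hull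
INFLATION `μ(ⁿ˒°𝒰) = μ(U) + (j²−1)·log p`, `kSetting_inflation`):

* `kSetting_image_logvol` — EVERY possible image at the label `j = i+1` has packet log-volume `−j²·log p` (honest `j²`-scaling, exact);
* `kSetting_imageChoice_processionNormalized` — hence EVERY global possible image has procession-normalised volume
  `PN_j(−j²·log p) = −(5/2)·log p`;
* `kSetting_not_dominated_perPacket` / `kSetting_not_dominated` — `< −log p = −|log(q)|`: NO global possible image dominates the
  `q`-pilot volume (per-packet form, and c312-6's assembled form via `assemble_logvol_imageChoice_eq_processionNormalized`);
* `kSetting_bridgeHyps_statement_not_dominated` — the separating conjunction; `statement_not_imp_dominated` — so the converse of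
  `Verbatim.statement_of_dominated` FAILS over all settings even under `BridgeHyps`: at the verbatim statement of [IUTchIII]
  Cor. 3.12, LANA's (9-1) ORDER variant is STRICTLY STRONGER than the typed inequality (the bed realises the inequality by
  inflation alone — the Scholze–Stix `j²` picture in miniature, [cite: ScholzeStix2018, §2.2 pp. 9–10]).

[claim: Mochizuki2012, status: disputed] [cite: LANA2026Report, §9.2 (9-1) p. 46]
-/

noncomputable section

namespace Summit.ABC

namespace IUTFork

namespace Repair.RcatLana91Order.Coset

open Set Thm311 Cor312 Cor312.Checks Cor312Vol Cor312Vol.NaiveWitness Cor312Vol.UnitWitness Cor312Vol.UnitCoset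
  Cor312Vol.UnitCosetCoarse Literature.IUT.LogThetaLattice

variable (p : ℕ) [hp : Fact p.Prime]

/-- **Every possible image at the label `j = i+1 ∈ 𝔽_l^⋇` of the coarse-coset bed has packet log-volume `−j²·log p`** (from
w4-d101's exact inflation identity `μ(ⁿ˒°𝒰) = μ(U) + (j²−1)·log p` and `ⁿ˒°𝒰 = q𝒪` of volume `−log p`). [folklore] -/
theorem kSetting_image_logvol (i : Fin toyIndex.lstar) (vQ : toyIndex.VQ)
    {U : Set ((unitShells p).Packet (Setting.labelSucc i) vQ)}
    (hU : U ∈ (kSetting p).possibleImages (Setting.labelSucc i) vQ) :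
    ((kSituation p).D (kSetting p).n).logvol (Setting.labelSucc i) vQ U =
      -((((i : ℕ) + 1 : ℕ) : ℝ) ^ 2) * Real.log p := by
  have h := (kSetting_inflation p i vQ hU).2
  rw [kSetting_thetaHull p (Setting.labelSucc_ne_zero i), kLine_logvol, bvol_uBall] at h
  have hj : ((jsq (Setting.labelSucc i) : ℤ) : ℝ) = (((i : ℕ) + 1 : ℕ) : ℝ) ^ 2 := by
    unfold jsq Setting.labelSucc
    rw [Fin.val_succ]
    push_cast
    ring
  rw [hj] at h
  show (kLine p 0).logvol _ vQ U = _
  push_cast at h ⊢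
  linarith

/-- **Hence every GLOBAL possible image has procession-normalised packet volume `−(5/2)·log p`** (`l⋇ = 2`: the average of
`−1·log p` and `−4·log p`; one place). [folklore] -/
theorem kSetting_imageChoice_processionNormalized (U : ImageChoice (kSetting p)) :
    processionNormalized (fun i : Fin toyIndex.lstar => ∑ᶠ vQ : toyIndex.VQ,
        ((kSituation p).D (kSetting p).n).logvol (Setting.labelSucc i) vQ (U.1 (i, vQ))) =
      -(5 / 2 : ℝ) * Real.log p := by
  have h : (fun i : Fin toyIndex.lstar => ∑ᶠ vQ : toyIndex.VQ,
      ((kSituation p).D (kSetting p).n).logvol (Setting.labelSucc i) vQ (U.1 (i, vQ))) =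
      fun i : Fin toyIndex.lstar => -((((i : ℕ) + 1 : ℕ) : ℝ) ^ 2) * Real.log p := by
    funext i
    rw [finsum_unique]
    exact kSetting_image_logvol p i _ (U.2 (i, _))
  rw [h]
  unfold processionNormalized
  show (∑ j : Fin 2, -((((j : ℕ) + 1 : ℕ) : ℝ) ^ 2) * Real.log p) / ((2 : ℕ) : ℝ) = _
  rw [Fin.sum_univ_two, Fin.val_zero, Fin.val_one]
  push_cast
  ring

/-- **NO global possible image dominates `−|log(q)| = −log p`** (per-packet form): `−(5/2)·log p < −log p`. [folklore] -/
theorem kSetting_not_dominated_perPacket :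
    ¬ ∃ U : ImageChoice (kSetting p), (kSetting p).negLogQ ≤
      processionNormalized fun i : Fin toyIndex.lstar => ∑ᶠ vQ : toyIndex.VQ,
        ((kSituation p).D (kSetting p).n).logvol (Setting.labelSucc i) vQ (U.1 (i, vQ)) := by
  rintro ⟨U, hU⟩
  rw [kSetting_negLogQ, kSetting_imageChoice_processionNormalized] at hU
  have hp0 := log_p_pos p
  linarith

/-- **… nor in abc-iut-c312-6's assembled form** (the hypothesis shape of `Verbatim.statement_of_dominated`). [folklore] -/
theorem kSetting_not_dominated :
    ¬ ∃ U : ImageChoice (kSetting p), (kSetting p).negLogQ ≤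
      (toLocalFamily (kSetting p) (kSetting_bridgeHyps p).mono).assemble.logvol (Set.univ.pi U.1) := by
  rintro ⟨U, hU⟩
  rw [Verbatim.assemble_logvol_imageChoice_eq_processionNormalized (kSetting_bridgeHyps p) U] at hU
  exact kSetting_not_dominated_perPacket p ⟨U, hU⟩

/-- **THE VERBATIM-LEVEL SEPARATION: `BridgeHyps` ∧ `Statement` ∧ ¬dominated** at the coarse-coset bed — the typed Cor. 3.12
holds there (with equality, by hull inflation) while every possible image of the Θ-pilot object is SMALLER than the `q`-pilot
image in volume. [folklore] -/
theorem kSetting_bridgeHyps_statement_not_dominated :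
    BridgeHyps (kSetting p) ∧ (kSetting p).Statement ∧
      ¬ ∃ U : ImageChoice (kSetting p), (kSetting p).negLogQ ≤
        processionNormalized fun i : Fin toyIndex.lstar => ∑ᶠ vQ : toyIndex.VQ,
          ((kSituation p).D (kSetting p).n).logvol (Setting.labelSucc i) vQ (U.1 (i, vQ)) :=
  ⟨kSetting_bridgeHyps p, kSetting_statement p, kSetting_not_dominated_perPacket p⟩

omit hp in
/-- **The converse of `Verbatim.statement_of_dominated` FAILS over all settings, even under `BridgeHyps`** (witness: the
coarse-coset bed at `p = 2`): at the verbatim statement LANA's (9-1) ORDER variant is STRICTLY STRONGER than the typed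
inequality. [folklore] -/
theorem statement_not_imp_dominated :
    ¬ ∀ (T : Thm311.ThetaIndex) (S : Thm311.Situation T) (P : Cor312.Setting S) (H : BridgeHyps P), P.Statement →
      ∃ U : ImageChoice P, P.negLogQ ≤ (toLocalFamily P H.mono).assemble.logvol (Set.univ.pi U.1) := by
  haveI : Fact (Nat.Prime 2) := ⟨Nat.prime_two⟩
  exact fun h => kSetting_not_dominated 2 (h _ _ _ (kSetting_bridgeHyps 2) (kSetting_statement 2))

end Repair.RcatLana91Order.Coset

end IUTFork

end Summit.ABC

end
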